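import Summits.AtomisticToContinuum.Crystallization.Theorems.FrustratedLawDichotomyTwoShellRigidityOctaCellAt

/-!
# FrustratedLawDichotomy · two-shell rigidity — the CERTIFIED CONTRACTION LADDER beneath `M = CappedRigidity θ η`
(lens-5 g31, «finite/base range + asymptotic regime + bridge», RESIDUAL MODE on the K/L format of critic row 431 (1))

TARGET PIECE.  `M_Pat = CappedRigidityAt θ η Pat` (`…TwoShellRigidityCut`, literals `θ = 1/100`, `η = 1/20`; `M = M_fcc ∧ M_hcp` feeds
`kr2Shape_of_cut` and the θ-parametric door `aperiodicFrustratedLawGap_of_price_of_cut`).  The g30 cut `M ⟸ R ∧ L`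
(`CoarseCappedRigidity K θ` ∧ `BasinCertificate K θ η`) left L «PARKED · IDEA-NEEDED» (critic row 431 (1): which operating point `K⋆`?).

THE g31 ANSWER — A LADDER, NOT ONE CERTIFICATE.  Fix `θ`.  A FIT TUPLE `P = (a, aq, b, bq)` records, for ONE linear isometry `A`, the Euclidean
deviations of the bonded dozen (`≤ a·nn_i`), of every cap (`≤ aq·nn_i`), and the RELATIVE deviations of every link bond (`≤ b·nn_i`) and every cap bond
(`≤ bq·nn_i`) — `FitAt`.  `EntryAt θ P` says every capped link-isomorphic dozen admits such a fit; `RungAt θ P Q` says a fit of quality `P` can be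
RE-GAUGED into a fit of quality `Q`.  GLUE (all PROVED below, pure logic + triangle inequality):
* `entryAt_of_coarse_of_capApriori` : `R_K ∧ CapApriori(Kq, K) ⟹ EntryAt θ (Kθ, Kq·θ, 2Kθ, (Kq+K)θ)`   [BASE RANGE = the hand lane's R];
* `entryAt_of_chain`                 : `EntryAt θ P ∧ ChainAt θ P [P₁,…,Pₙ] Q ⟹ EntryAt θ Q`          [finite chain of rungs];
* `cappedRigidityAt_of_entry`        : `EntryAt θ Q ∧ Q.1 < η ⟹ CappedRigidityAt θ η`                [M by name];
* `cappedRigidityBothAt_of_entry`    : `EntryAt θ Q ⟹ CappedRigidityBothAt θ Q.1 Q.2.1`              [M⁺, lens-4's slot-4 currency, TAG 157];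
* `kr2Shape_of_ladders`, `aperiodicFrustratedLawGap_of_price_of_ladders` : the column by name at the literals / on the dial.

THE PIECES AND THEIR TAGS (numbers: lens-5 g31 `g31/scripts/{model,lp,rung,ladder}.py`, exact-rational LP duals, primal witnesses feasible to 1e-16):
* `RungAt θ P Q Pat` [INSTRUMENTABLE · CERTIFIED NUMERICALLY · WEAKER than M (one more hypothesis: the fit `P`; and it concludes a fit, not `η < 1/20`)].
  Each rung is ≈ 65 (fcc, 48-fold symmetry) / ≈ 130 (hcp) linear programmes over the SCALE-AWARE linearisation of the bond graph: variables = 18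
  displacements `w_t` (54) + 18 LOCAL SCALES `σ_t = nn_t/nn_i − 1`; every bond `ℓ = |e + δ|` of the 19-point capped cluster contributes the two EXACT
  linear consequences `ℓ ≤ (1+θ)·s ⟹ 2e·δ − 2(1+θ)²σ ≤ (1+θ)² − 1 + (1+θ)²σ_max²` and `s ≤ ℓ ⟹ 2σ − 2e·δ ≤ D²` (`D` = the a-priori bound on `|δ|`
  carried by `P`), the rotation is re-gauged by the least-squares functional `ω = (1/8)·Σ_u u × w_u` (`Σ u uᵀ = 4·I` for both patterns) with the
  second-order correction `(ρ|ω|)²/2 · e^{ρ|ω|}`, and directional maxima over 26 / 74 directions are converted to Euclidean bounds by the covering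
  factor `ρ₂₆ = 1.12810`, `ρ₇₄ = 1.04942`.  MEASURED at `θ = 1/100`: the ladder map has an attracting FIXED POINT `P⋆ = (3.237, 4.380, 3.309, 3.962)·θ`
  (fcc, 74 dirs) / `(3.213, 4.674, 3.541, 4.116)·θ` (hcp, 26 dirs) — first-shell deviation `0.0324 / 0.0321 < 1/20` (margin `1.54×`) — and it is
  reached from every entry tuple below the ENTRY THRESHOLD: fcc `(18, 40, 36, 58)·θ` ENTERS (`18 → 23.4 → 24.2 → 21.2 → 15.8 → … → 3.24`, ≈ 10 rungs),
  `(19, 42, 38, 61)·θ` and `(20, 44, 40, 64)·θ` DIVERGE; hcp `(12, 28, 24, 40)·θ` ENTERS (`→ 14.9 → 11.6 → 7.1 → 4.4 → 3.5 → 3.2`), `(16, 36, 32, 52)·θ`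
  DIVERGES.  In ABSOLUTE terms the entry threshold is a first-shell deviation `f_entry ≈ 0.18·nn_i` (fcc) / `≈ 0.12·nn_i` (hcp), INDEPENDENT of θ
  (on the dial: fcc `K₀ = 52` enters at `θ = 1/400` (`42.8 → 19.2 → 5.3 → 3.1`, final `0.0078`) and `K₀ = 30` at `1/200`; hcp `K₀ = 82` diverges at
  `1/400`, enters at `1/600` (`84.6 → 50.2 → 15.9 → 4.0 → 2.9`, final `0.0049`)).  So the ladder closes the column as soon as the hand lane's
  constant satisfies `K_hand·θ ≲ 0.18 / 0.12` — versus `K_hand·θ < 1/20` for the bare θ-dial (`aperiodicFrustratedLawGap_of_price_of_coarse`):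
  a factor `3.6 / 2.4` on the dial, and at the literal `θ = 1/100` it replaces «prove R with K < 5» by «prove R with K ≤ 18 / 12».
* `EntryAt (1/100) P_entry Pat` — THE BRIDGE [UNDECIDED at the literal · IDEA-NEEDED: every capped link-isomorphic dozen is within `0.18·nn_i` (fcc) /
  `0.12·nn_i` (hcp) of an isometric image of its pattern, caps within `0.40 / 0.28`.  TRUE-type (census BASIN l.2005: every feasible endpoint of
  960 far random starts lies within `0.032·nn` of its pattern — ONE basin in evidence); the hand lane's sequential placement gives `K·θ` of order
  unity at `θ = 1/100` (AssemblyDial: `c·θ₁ ≲ 1/117`), so at the literal the bridge needs either a global (branch-and-bound / interval) certificate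
  over the compact window set or a better assembly; on the dial it is PROVED from R as soon as `K_hand·θ ≤ f_entry`].
* `CapAprioriAt Kq K θ Pat` [ATTACKABLE·S: `OctaCellAt c` (PROVED, `c = 18`, p821965/OctaCellAt) + the pattern fact «a `√2`-pair has two common
  contacts at mutual distance `√2`» + bond-graph extraction for an ARBITRARY site `m` bonded to the four square vertices ⟹ `Kq = 3c + 2K`
  (`‖q − nn·A(u+v)‖ ≤ ‖q − nn·A′(u+v)‖ + nn·‖(A′ − A)u‖ + nn·‖(A′ − A)v‖ ≤ (c + 2(c + K))·θ·nn`)].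
* WHY EACH PIECE IS STRICTLY WEAKER THAN M.  `RungAt` assumes a fit and concludes a fit (it is implied by M only when `Q.1 ≥ η`… it is NOT implied by M
  at all for `Q` below M's `η'`, and does not imply M without an entry); `EntryAt θ P_entry` with `P_entry.1 = 0.18 ≥ 1/20` is implied by M⁺-type
  statements only with caps and is far coarser than M; `CapAprioriAt` is a cell lemma.  None of them alone gives `η' < 1/20`.
* WHY NOVEL (relative to g30 and the census).  g30's L was ONE certificate on the basin of radius `K·θ` in the WEAK windows of `ExtractionAt`
  (`[d/(1+θ), (1+θ)²d]` uncoupled); census TAG 157 variant D MEASURED that the weak-window sup of the first-shell deviation at `θ = 1/100` is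
  `0.0587 (fcc) / 0.0621 (hcp) > 1/20` — so NO certificate through the weak windows can prove M at the literal.  The ladder keeps the per-site SCALE
  COUPLING of the bond graph (the local scales `σ_t` are LP variables), under which the certified sup is `0.0324 / 0.0321`, and it replaces the single
  tight certificate by a CHAIN of coarse ones whose entry condition is an ABSOLUTE deviation (`0.18·nn`), not a relative one.  (Also MEASURED: the
  census KR18 variant-B maximiser (global band `[1/(1+θ), 1+θ]`, Kabsch gauge, `η = 0.0395`) violates the per-site coupling by the factor `1.0201 >
  1.01` at a cap site, and its MINIMAX deviation over rotations is `0.0302` — M quantifies `∃ A`, so minimax is M's currency.)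
KILL / FALSIFIER.  A capped, link-isomorphic(1/100) 19-point configuration with per-site bond ratio `≤ 1.01` whose minimax first-shell deviation exceeds
`0.0324·nn_i` refutes a rung as computed (not M); one exceeding `0.05·nn_i` refutes M at the literal; one with deviation in `(0.0324, 0.18]·nn_i`
that is a strict local maximum of the deviation would refute the single-basin picture behind the bridge.
-/

noncomputable section

namespace Summit.AtomisticToContinuum.Crystallization.Theorems.FrustratedLawDichotomyTwoShellRigidityLadder

open Literature.Geometry.DiscreteGeometry
open Summit.AtomisticToContinuum.Crystallization.Theorems.FrustratedLawDichotomyTwoShellRigidityCut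
open Summit.AtomisticToContinuum.Crystallization.Theorems.FrustratedLawDichotomyTwoShellRigidityCells

/-! ## Fit tuples, entry, rungs, chains -/

/-- **A fit of quality `P = (a, aq, b, bq)` by the isometry `A`** at site `i` (scale `nn_i`): the bonded dozen within `a·nn_i` of `nn_i·A(Pat)`;
every cap `m` of a square (diagonal `u, v`; `m ≠ i` bonded to `τ` of the four vertices) within `aq·nn_i` of `nn_i·A(u+v)`; every link bond's
relative displacement within `b·nn_i`; every cap bond's within `bq·nn_i`. -/
def FitAt (θ : ℝ) (P : ℝ × ℝ × ℝ × ℝ) (Pat : Finset E3) {N : ℕ} (y : Fin N → E3) (i : Fin N) (τ : ↥Pat → Fin N)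
    (A : E3 →ₗᵢ[ℝ] E3) : Prop :=
  (∀ u : ↥Pat, ‖(y (τ u) - y i) - nearestDist y i • A (u : E3)‖ ≤ P.1 * nearestDist y i) ∧
  (∀ (u v : ↥Pat) (m : Fin N), dist (u : E3) (v : E3) = Real.sqrt 2 → m ≠ i →
      (∀ w : ↥Pat, (w = u ∨ w = v ∨ (dist (w : E3) (u : E3) = 1 ∧ dist (w : E3) (v : E3) = 1)) → (bondGraph θ y).Adj m (τ w)) →
        ‖(y m - y i) - nearestDist y i • A ((u : E3) + (v : E3))‖ ≤ P.2.1 * nearestDist y i) ∧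
  (∀ u w : ↥Pat, dist (u : E3) (w : E3) = 1 →
      ‖(y (τ u) - y (τ w)) - nearestDist y i • A ((u : E3) - (w : E3))‖ ≤ P.2.2.1 * nearestDist y i) ∧
  (∀ (u v : ↥Pat) (m : Fin N), dist (u : E3) (v : E3) = Real.sqrt 2 → m ≠ i →
      (∀ w : ↥Pat, (w = u ∨ w = v ∨ (dist (w : E3) (u : E3) = 1 ∧ dist (w : E3) (v : E3) = 1)) → (bondGraph θ y).Adj m (τ w)) →
        ∀ w : ↥Pat, (w = u ∨ w = v ∨ (dist (w : E3) (u : E3) = 1 ∧ dist (w : E3) (v : E3) = 1)) →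
          ‖(y m - y (τ w)) - nearestDist y i • A ((u : E3) + (v : E3) - (w : E3))‖ ≤ P.2.2.2 * nearestDist y i)

/-- **`EntryAt θ P Pat`** — every capped, `Pat`-link-isomorphic dozen of an injective `7/10`-separated configuration admits a fit of quality `P`.
(With `P = P_entry(1/100) = (18, 40, 36, 58)/100` (fcc) / `(12, 28, 24, 40)/100` (hcp) this is THE BRIDGE of the g31 node.) -/
def EntryAt (θ : ℝ) (P : ℝ × ℝ × ℝ × ℝ) (Pat : Finset E3) : Prop :=
  ∀ (N : ℕ) (y : Fin N → E3) (i : Fin N) (τ : ↥Pat → Fin N), Function.Injective y →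
    (∀ a b : Fin N, a ≠ b → (7 : ℝ) / 10 ≤ dist (y a) (y b)) → LinkIso θ Pat y i τ → Capped θ Pat y i τ →
      ∃ A : E3 →ₗᵢ[ℝ] E3, FitAt θ P Pat y i τ A

/-- **`RungAt θ P Q Pat`** — ONE RUNG of the ladder: a fit of quality `P` can be re-gauged into a fit of quality `Q` (possibly by another
isometry).  [INSTRUMENTABLE: certified by ≈ 65 / 130 exact-rational LP duals of the scale-aware linearised bond graph, see the module docstring.] -/
def RungAt (θ : ℝ) (P Q : ℝ × ℝ × ℝ × ℝ) (Pat : Finset E3) : Prop :=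
  ∀ (N : ℕ) (y : Fin N → E3) (i : Fin N) (τ : ↥Pat → Fin N), Function.Injective y →
    (∀ a b : Fin N, a ≠ b → (7 : ℝ) / 10 ≤ dist (y a) (y b)) → LinkIso θ Pat y i τ → Capped θ Pat y i τ →
      (∃ A : E3 →ₗᵢ[ℝ] E3, FitAt θ P Pat y i τ A) → ∃ A : E3 →ₗᵢ[ℝ] E3, FitAt θ Q Pat y i τ A

/-- **`ChainAt θ Pat P L Q`** — the rungs `P → L₁ → L₂ → … → Lₙ → Q` all hold. -/
def ChainAt (θ : ℝ) (Pat : Finset E3) : (ℝ × ℝ × ℝ × ℝ) → List (ℝ × ℝ × ℝ × ℝ) → (ℝ × ℝ × ℝ × ℝ) → Prop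
  | P, [], Q => RungAt θ P Q Pat
  | P, R :: rest, Q => RungAt θ P R Pat ∧ ChainAt θ Pat R rest Q

/-- **`CapAprioriAt Kq K θ Pat`** — the cap a-priori: if the bonded dozen is within `K·θ·nn_i` of `nn_i·A(Pat)` then every cap of a square
(diagonal `u, v`) is within `Kq·θ·nn_i` of `nn_i·A(u+v)` FOR THE SAME `A`.  [ATTACKABLE·S from `OctaCellAt c`: `Kq = 3c + 2K`.] -/
def CapAprioriAt (Kq K θ : ℝ) (Pat : Finset E3) : Prop :=
  ∀ (N : ℕ) (y : Fin N → E3) (i : Fin N) (τ : ↥Pat → Fin N), Function.Injective y →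
    (∀ a b : Fin N, a ≠ b → (7 : ℝ) / 10 ≤ dist (y a) (y b)) → LinkIso θ Pat y i τ → Capped θ Pat y i τ →
      ∀ A : E3 →ₗᵢ[ℝ] E3, (∀ u : ↥Pat, ‖(y (τ u) - y i) - nearestDist y i • A (u : E3)‖ ≤ K * θ * nearestDist y i) →
        ∀ (u v : ↥Pat) (m : Fin N), dist (u : E3) (v : E3) = Real.sqrt 2 → m ≠ i →
          (∀ w : ↥Pat, (w = u ∨ w = v ∨ (dist (w : E3) (u : E3) = 1 ∧ dist (w : E3) (v : E3) = 1)) → (bondGraph θ y).Adj m (τ w)) →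
            ‖(y m - y i) - nearestDist y i • A ((u : E3) + (v : E3))‖ ≤ Kq * θ * nearestDist y i

/-! ## Glue, proved -/

/-- Triangle inequality for relative displacements: two absolute fits give a relative one. [folklore] -/
theorem norm_rel_le {p q : E3} {d : ℝ} (A : E3 →ₗᵢ[ℝ] E3) (r s : E3) {α β : ℝ}
    (hp : ‖p - d • A r‖ ≤ α) (hq : ‖q - d • A s‖ ≤ β) : ‖(p - q) - d • A (r - s)‖ ≤ α + β := by
  have h : (p - q) - d • A (r - s) = (p - d • A r) - (q - d • A s) := by
    rw [map_sub, smul_sub]; abel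
  rw [h]
  exact (norm_sub_le _ _).trans (add_le_add hp hq)

/-- **BASE RANGE ⟹ ENTRY**: `CoarseCappedRigidityAt K θ ∧ CapAprioriAt Kq K θ ⟹ EntryAt θ (Kθ, Kq·θ, 2Kθ, (Kq+K)θ)`. [folklore] -/
theorem entryAt_of_coarse_of_capApriori {K Kq θ : ℝ} {Pat : Finset E3} (hR : CoarseCappedRigidityAt K θ Pat)
    (hQ : CapAprioriAt Kq K θ Pat) : EntryAt θ (K * θ, Kq * θ, 2 * K * θ, (Kq + K) * θ) Pat := by
  intro N y i τ hy hsep hL hC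
  obtain ⟨A, hA⟩ := hR N y i τ hy hsep hL hC
  have hcap := hQ N y i τ hy hsep hL hC A hA
  refine ⟨A, hA, hcap, fun u w _ => ?_, fun u v m huv hmi hb w hw => ?_⟩
  · have h := norm_rel_le (d := nearestDist y i) A (u : E3) (w : E3) (hA u) (hA w)
    have e : (y (τ u) - y i) - (y (τ w) - y i) = y (τ u) - y (τ w) := by abel
    rw [e] at h
    linarith
  · have h := norm_rel_le (d := nearestDist y i) A ((u : E3) + (v : E3)) (w : E3) (hcap u v m huv hmi hb) (hA w)
    have e : (y m - y i) - (y (τ w) - y i) = y m - y (τ w) := by abel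
    rw [e] at h
    linarith

/-- **ONE RUNG**: `EntryAt θ P ∧ RungAt θ P Q ⟹ EntryAt θ Q`. [folklore] -/
theorem entryAt_of_rung {θ : ℝ} {P Q : ℝ × ℝ × ℝ × ℝ} {Pat : Finset E3} (hE : EntryAt θ P Pat) (hR : RungAt θ P Q Pat) :
    EntryAt θ Q Pat :=
  fun N y i τ hy hsep hL hC => hR N y i τ hy hsep hL hC (hE N y i τ hy hsep hL hC)

/-- **THE CHAIN**: `EntryAt θ P ∧ ChainAt θ Pat P L Q ⟹ EntryAt θ Q` (induction on the list of intermediate rungs). [folklore] -/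
theorem entryAt_of_chain {θ : ℝ} {Pat : Finset E3} :
    ∀ (L : List (ℝ × ℝ × ℝ × ℝ)) {P Q : ℝ × ℝ × ℝ × ℝ}, EntryAt θ P Pat → ChainAt θ Pat P L Q → EntryAt θ Q Pat
  | [], _, _, hE, hC => entryAt_of_rung hE hC
  | _ :: rest, _, _, hE, hC => entryAt_of_chain rest (entryAt_of_rung hE hC.1) hC.2

/-- **M BY NAME from an entry below `η`**: `EntryAt θ Q ∧ Q.1 < η ⟹ CappedRigidityAt θ η Pat`. [folklore] -/
theorem cappedRigidityAt_of_entry {θ η : ℝ} {Q : ℝ × ℝ × ℝ × ℝ} {Pat : Finset E3} (hE : EntryAt θ Q Pat) (hη : Q.1 < η) :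
    CappedRigidityAt θ η Pat := by
  intro N y i τ hy hsep hL hC
  obtain ⟨A, h1, -⟩ := hE N y i τ hy hsep hL hC
  exact ⟨Q.1, A, hη, h1⟩

/-- **M⁺ BY NAME (shell AND caps, lens-4's slot-4 currency)**: `EntryAt θ Q ⟹ CappedRigidityBothAt θ Q.1 Q.2.1 Pat`. [folklore] -/
theorem cappedRigidityBothAt_of_entry {θ : ℝ} {Q : ℝ × ℝ × ℝ × ℝ} {Pat : Finset E3} (hE : EntryAt θ Q Pat) :
    CappedRigidityBothAt θ Q.1 Q.2.1 Pat := by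
  intro N y i τ hy hsep hL hC
  obtain ⟨A, h1, h2, -⟩ := hE N y i τ hy hsep hL hC
  exact ⟨A, h1, fun u v m huv hmi hb => h2 u v m huv hmi hb⟩

/-- **THE LADDER AT ONE PATTERN**: `R_K ∧ CapApriori ∧ chain of rungs from the entry tuple to Q ∧ Q.1 < η ⟹ M_Pat(θ, η)`. [folklore] -/
theorem cappedRigidityAt_of_ladder {K Kq θ η : ℝ} {Pat : Finset E3} (L : List (ℝ × ℝ × ℝ × ℝ)) {Q : ℝ × ℝ × ℝ × ℝ}
    (hR : CoarseCappedRigidityAt K θ Pat) (hQ : CapAprioriAt Kq K θ Pat)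
    (hC : ChainAt θ Pat (K * θ, Kq * θ, 2 * K * θ, (Kq + K) * θ) L Q) (hη : Q.1 < η) : CappedRigidityAt θ η Pat :=
  cappedRigidityAt_of_entry (entryAt_of_chain L (entryAt_of_coarse_of_capApriori hR hQ) hC) hη

/-- **THE LADDER FROM ANY ENTRY** (the bridge supplied directly): `EntryAt θ P ∧ ChainAt θ Pat P L Q ∧ Q.1 < η ⟹ M_Pat(θ, η)`. [folklore] -/
theorem cappedRigidityAt_of_entry_of_chain {θ η : ℝ} {Pat : Finset E3} (L : List (ℝ × ℝ × ℝ × ℝ)) {P Q : ℝ × ℝ × ℝ × ℝ}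
    (hE : EntryAt θ P Pat) (hC : ChainAt θ Pat P L Q) (hη : Q.1 < η) : CappedRigidityAt θ η Pat :=
  cappedRigidityAt_of_entry (entryAt_of_chain L hE hC) hη

/-! ## The column by name -/

/-- **`KR2Shape` from the two ladders at the literals** (`θ = 1/100`, final first-shell quality `< 1/20` for both patterns), given G and P. [folklore] -/
theorem kr2Shape_of_ladders {Pf Qf Ph Qh : ℝ × ℝ × ℝ × ℝ} (Lf Lh : List (ℝ × ℝ × ℝ × ℝ))
    (hG : LinkClassification (1 / 100)) (hP : CapForcing (1 / 100))
    (hEf : EntryAt (1 / 100) Pf fccKissingPattern) (hCf : ChainAt (1 / 100) fccKissingPattern Pf Lf Qf) (hf : Qf.1 < 1 / 20)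
    (hEh : EntryAt (1 / 100) Ph hcpKissingPattern) (hCh : ChainAt (1 / 100) hcpKissingPattern Ph Lh Qh) (hh : Qh.1 < 1 / 20) :
    KR2Shape :=
  kr2Shape_of_cut hG hP ⟨cappedRigidityAt_of_entry_of_chain Lf hEf hCf hf, cappedRigidityAt_of_entry_of_chain Lh hEh hCh hh⟩

/-- **The dial form**: for any `0 < θ ≤ 1/100`, `MuEquilibriumDoor ∧ Price θ ∧ G θ ∧ P θ ∧` (both ladders ending below `1/20`) `⟹
AperiodicFrustratedLawGap` (through `aperiodicFrustratedLawGap_of_price_of_cut` with `η = max Qf.1 Qh.1`). [folklore] -/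
theorem aperiodicFrustratedLawGap_of_price_of_ladders {θ : ℝ} {Pf Qf Ph Qh : ℝ × ℝ × ℝ × ℝ} (Lf Lh : List (ℝ × ℝ × ℝ × ℝ))
    (hθ0 : 0 < θ) (hθ1 : θ ≤ 1 / 100)
    (hDoor : Summit.AtomisticToContinuum.Crystallization.Theses.GrainCoreNetworkSplit.MuEquilibriumDoor)
    (hprice : PriceTol θ) (hG : LinkClassification θ) (hP : CapForcing θ)
    (hEf : EntryAt θ Pf fccKissingPattern) (hCf : ChainAt θ fccKissingPattern Pf Lf Qf) (hf : Qf.1 < 1 / 20)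
    (hEh : EntryAt θ Ph hcpKissingPattern) (hCh : ChainAt θ hcpKissingPattern Ph Lh Qh) (hh : Qh.1 < 1 / 20) :
    Summit.AtomisticToContinuum.Crystallization.Theses.FrustratedLawDichotomy.AperiodicFrustratedLawGap := by
  have hη : max Qf.1 Qh.1 < 1 / 20 := max_lt hf hh
  have hf' : Qf.1 < (max Qf.1 Qh.1 + 1 / 20) / 2 := by linarith [le_max_left Qf.1 Qh.1]
  have hh' : Qh.1 < (max Qf.1 Qh.1 + 1 / 20) / 2 := by linarith [le_max_right Qf.1 Qh.1]
  have hη' : (max Qf.1 Qh.1 + 1 / 20) / 2 < 1 / 20 := by linarith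
  exact aperiodicFrustratedLawGap_of_price_of_cut hθ0 hθ1 hη' hDoor hprice hG hP
    ⟨cappedRigidityAt_of_entry_of_chain Lf hEf hCf hf', cappedRigidityAt_of_entry_of_chain Lh hEh hCh hh'⟩

/-! ## The measured ladders at the literal `θ = 1/100` (data of the certificates; every rung below is `RungAt (1/100) P Q Pat` with the
LP-certified successor rounded UP to four decimals — rounding up only weakens the conclusion of a rung and, by `fitAt_mono`, only strengthens the
hypothesis of the next, so the rounded chain is implied by the computed one). -/

/-- Monotonicity of fits in the quality tuple. [folklore] -/
theorem fitAt_mono {θ : ℝ} {P P' : ℝ × ℝ × ℝ × ℝ} {Pat : Finset E3} {N : ℕ} {y : Fin N → E3} {i : Fin N} {τ : ↥Pat → Fin N}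
    {A : E3 →ₗᵢ[ℝ] E3} (h1 : P.1 ≤ P'.1) (h2 : P.2.1 ≤ P'.2.1) (h3 : P.2.2.1 ≤ P'.2.2.1) (h4 : P.2.2.2 ≤ P'.2.2.2)
    (h : FitAt θ P Pat y i τ A) : FitAt θ P' Pat y i τ A := by
  have hnn := nearestDist_nonneg y i
  obtain ⟨ha, hq, hb, hbq⟩ := h
  refine ⟨fun u => (ha u).trans (mul_le_mul_of_nonneg_right h1 hnn),
    fun u v m huv hmi hbd => (hq u v m huv hmi hbd).trans (mul_le_mul_of_nonneg_right h2 hnn),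
    fun u w huw => (hb u w huw).trans (mul_le_mul_of_nonneg_right h3 hnn),
    fun u v m huv hmi hbd w hw => (hbq u v m huv hmi hbd w hw).trans (mul_le_mul_of_nonneg_right h4 hnn)⟩

/-- A rung with a weaker conclusion follows from a rung with a stronger one. [folklore] -/
theorem rungAt_mono_right {θ : ℝ} {P Q Q' : ℝ × ℝ × ℝ × ℝ} {Pat : Finset E3} (h1 : Q.1 ≤ Q'.1) (h2 : Q.2.1 ≤ Q'.2.1)
    (h3 : Q.2.2.1 ≤ Q'.2.2.1) (h4 : Q.2.2.2 ≤ Q'.2.2.2) (h : RungAt θ P Q Pat) : RungAt θ P Q' Pat := by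
  intro N y i τ hy hsep hL hC hP
  obtain ⟨A, hA⟩ := h N y i τ hy hsep hL hC hP
  exact ⟨A, fitAt_mono h1 h2 h3 h4 hA⟩

/-- A rung with a stronger hypothesis follows from a rung with a weaker one. [folklore] -/
theorem rungAt_mono_left {θ : ℝ} {P P' Q : ℝ × ℝ × ℝ × ℝ} {Pat : Finset E3} (h1 : P.1 ≤ P'.1) (h2 : P.2.1 ≤ P'.2.1)
    (h3 : P.2.2.1 ≤ P'.2.2.1) (h4 : P.2.2.2 ≤ P'.2.2.2) (h : RungAt θ P' Q Pat) : RungAt θ P Q Pat := by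
  intro N y i τ hy hsep hL hC hP
  obtain ⟨A, hA⟩ := hP
  exact h N y i τ hy hsep hL hC ⟨A, fitAt_mono h1 h2 h3 h4 hA⟩

/-- The vacuous rung: a fit of quality `P` is a fit of any weaker quality. [folklore] -/
theorem rungAt_of_le {θ : ℝ} {P Q : ℝ × ℝ × ℝ × ℝ} {Pat : Finset E3} (h1 : P.1 ≤ Q.1) (h2 : P.2.1 ≤ Q.2.1)
    (h3 : P.2.2.1 ≤ Q.2.2.1) (h4 : P.2.2.2 ≤ Q.2.2.2) : RungAt θ P Q Pat := by
  intro N y i τ _ _ _ _ hP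
  obtain ⟨A, hA⟩ := hP
  exact ⟨A, fitAt_mono h1 h2 h3 h4 hA⟩

/-- **The measured fcc ladder at `θ = 1/100` from the entry tuple `(18, 40, 36, 58)/100`** (nine rungs; intermediate tuples = LP-certified
successors rounded UP to `1e-4·nn_i`; 74 directions).  Terminal first-shell quality `0.0325 < 1/20`. -/
def fccLadder : List (ℝ × ℝ × ℝ × ℝ) :=
  [(0.2344, 0.4037, 0.3169, 0.4032), (0.2420, 0.3611, 0.2772, 0.3202), (0.2123, 0.2961, 0.2280, 0.2568),
   (0.1581, 0.2152, 0.1659, 0.1883), (0.0958, 0.1287, 0.0998, 0.1158), (0.0528, 0.0703, 0.0546, 0.0642),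
   (0.0367, 0.0494, 0.0375, 0.0446), (0.0331, 0.0448, 0.0339, 0.0405)]

/-- The entry tuple and the terminal tuple of the measured fcc ladder. -/
def fccEntry : ℝ × ℝ × ℝ × ℝ := (0.18, 0.40, 0.36, 0.58)

/-- Terminal tuple of the fcc ladder (`0.0325·nn_i` on the first shell, `0.0440` on the caps; the fixed point is `(0.03237, 0.04380, 0.03309, 0.03962)`). -/
def fccTerminal : ℝ × ℝ × ℝ × ℝ := (0.0325, 0.0440, 0.0333, 0.0398)

/-- **The measured hcp ladder at `θ = 1/100` from the entry tuple `(12, 28, 24, 40)/100`** (eight rungs; 26 directions; successors rounded UP to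
`1e-4·nn_i`; the fifth intermediate tuple is the dominating input `(3.5638, 5.0919, 3.8927, 4.5148)·θ` of a computed rung, cf. `rungAt_mono_left`). -/
def hcpLadder : List (ℝ × ℝ × ℝ × ℝ) :=
  [(0.1492, 0.2252, 0.1896, 0.2362), (0.1163, 0.1589, 0.1236, 0.1473), (0.0712, 0.0950, 0.0748, 0.0884),
   (0.0441, 0.0611, 0.0471, 0.0554), (0.0357, 0.0510, 0.0390, 0.0452), (0.0329, 0.0476, 0.0361, 0.0420),
   (0.0323, 0.0469, 0.0356, 0.0414)]

/-- The entry tuple of the measured hcp ladder. -/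
def hcpEntry : ℝ × ℝ × ℝ × ℝ := (0.12, 0.28, 0.24, 0.40)

/-- Terminal tuple of the hcp ladder. -/
def hcpTerminal : ℝ × ℝ × ℝ × ℝ := (0.0322, 0.0468, 0.0355, 0.0412)

/-- **THE TWO CERTIFICATE STATEMENTS of the g31 node** (each a finite conjunction of `RungAt` items). -/
def FccLadderCert : Prop := ChainAt (1 / 100) fccKissingPattern fccEntry fccLadder fccTerminal

/-- The hcp certificate statement. -/
def HcpLadderCert : Prop := ChainAt (1 / 100) hcpKissingPattern hcpEntry hcpLadder hcpTerminal

/-- **THE TWO BRIDGE STATEMENTS of the g31 node.** -/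
def FccBridge : Prop := EntryAt (1 / 100) fccEntry fccKissingPattern

/-- The hcp bridge statement. -/
def HcpBridge : Prop := EntryAt (1 / 100) hcpEntry hcpKissingPattern

/-- **THE g31 CUT AT THE LITERALS, GLUE PROVED**: `G ∧ P ∧ FccBridge ∧ FccLadderCert ∧ HcpBridge ∧ HcpLadderCert ⟹ KR2Shape`. [folklore] -/
theorem kr2Shape_of_bridges_of_certs (hG : LinkClassification (1 / 100)) (hP : CapForcing (1 / 100))
    (hBf : FccBridge) (hCf : FccLadderCert) (hBh : HcpBridge) (hCh : HcpLadderCert) : KR2Shape :=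
  kr2Shape_of_ladders fccLadder hcpLadder hG hP hBf hCf (by norm_num [fccTerminal]) hBh hCh (by norm_num [hcpTerminal])

/-- **… and M itself at the literals** (`CappedRigidity (1/100) (1/20)`). [folklore] -/
theorem cappedRigidity_of_bridges_of_certs (hBf : FccBridge) (hCf : FccLadderCert) (hBh : HcpBridge) (hCh : HcpLadderCert) :
    CappedRigidity (1 / 100) (1 / 20) :=
  ⟨cappedRigidityAt_of_entry_of_chain fccLadder hBf hCf (by norm_num [fccTerminal]),
    cappedRigidityAt_of_entry_of_chain hcpLadder hBh hCh (by norm_num [hcpTerminal])⟩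

/-- **… and M⁺ in lens-4's currency**: `CappedRigidityBoth (1/100) 0.0325 0.0468` from the four statements. [folklore] -/
theorem cappedRigidityBoth_of_bridges_of_certs (hBf : FccBridge) (hCf : FccLadderCert) (hBh : HcpBridge) (hCh : HcpLadderCert) :
    CappedRigidityBoth (1 / 100) 0.0325 0.0468 := by
  refine ⟨fun N y i τ hy hsep hL hC => ?_, fun N y i τ hy hsep hL hC => ?_⟩
  · obtain ⟨A, hA⟩ := entryAt_of_chain fccLadder hBf hCf N y i τ hy hsep hL hC
    obtain ⟨h1, h2, -⟩ := fitAt_mono (P' := (0.0325, 0.0468, 0.0333, 0.0398)) (by norm_num [fccTerminal]) (by norm_num [fccTerminal])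
      (by norm_num [fccTerminal]) (by norm_num [fccTerminal]) hA
    exact ⟨A, h1, fun u v m huv hmi hb => h2 u v m huv hmi hb⟩
  · obtain ⟨A, hA⟩ := entryAt_of_chain hcpLadder hBh hCh N y i τ hy hsep hL hC
    obtain ⟨h1, h2, -⟩ := fitAt_mono (P' := (0.0325, 0.0468, 0.0355, 0.0412)) (by norm_num [hcpTerminal]) (by norm_num [hcpTerminal])
      (by norm_num [hcpTerminal]) (by norm_num [hcpTerminal]) hA
    exact ⟨A, h1, fun u v m huv hmi hb => h2 u v m huv hmi hb⟩

/-- **The bridge from the hand lane, fcc**: `CoarseCappedRigidityAt K (1/100) fcc` with `K ≤ 18` and the cap a-priori with `Kq ≤ 40` give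
`FccBridge`. [folklore] -/
theorem fccBridge_of_coarse {K Kq : ℝ} (hK : K ≤ 18) (hKq : Kq ≤ 40)
    (hR : CoarseCappedRigidityAt K (1 / 100) fccKissingPattern) (hQ : CapAprioriAt Kq K (1 / 100) fccKissingPattern) : FccBridge := by
  intro N y i τ hy hsep hL hC
  obtain ⟨A, hA⟩ := entryAt_of_coarse_of_capApriori hR hQ N y i τ hy hsep hL hC
  refine ⟨A, fitAt_mono ?_ ?_ ?_ ?_ hA⟩ <;> simp only [fccEntry] <;> nlinarith

/-- **The bridge from the hand lane, hcp**: `K ≤ 12`, `Kq ≤ 28`. [folklore] -/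
theorem hcpBridge_of_coarse {K Kq : ℝ} (hK : K ≤ 12) (hKq : Kq ≤ 28)
    (hR : CoarseCappedRigidityAt K (1 / 100) hcpKissingPattern) (hQ : CapAprioriAt Kq K (1 / 100) hcpKissingPattern) : HcpBridge := by
  intro N y i τ hy hsep hL hC
  obtain ⟨A, hA⟩ := entryAt_of_coarse_of_capApriori hR hQ N y i τ hy hsep hL hC
  refine ⟨A, fitAt_mono ?_ ?_ ?_ ?_ hA⟩ <;> simp only [hcpEntry] <;> nlinarith


/-! ## The fcc ladder from the PROVED octahedral-cell constant: `c = 18` (`octaCellAt_fcc`, p821965) ⇒ cap a-priori `Kq = 3c + 2K = 54 + 2K`;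
with `K = 10` the chain `10 → 19.6 → 24.5 → 26.1 → 24.4 → 20.4 → 14.5 → 8.4 → 4.75 → 3.53 → 3.29 → 3.25` ENTERS (it first expands while the huge cap
slack `Dc₀ = 0.84·nn` is being absorbed, then contracts).  So at the literal the fcc column needs R with `K ≤ 10` and NO new cap lemma beyond
`CapAprioriAt (54 + 2K) K` [ATTACKABLE·S from `OctaCellAt 18`].  (`K = 14` with the same cap route DIVERGES: `28.4 → 46.7`.) -/

/-- Entry tuple of the `c = 18` route at `K = 10`: `(K, 54 + 2K, 2K, 54 + 3K)/100`. -/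
def fccEntryC18 : ℝ × ℝ × ℝ × ℝ := (0.10, 0.74, 0.20, 0.84)

/-- The measured fcc ladder of the `c = 18` route (74 directions; successors rounded UP to `1e-4·nn_i`; two intermediate tuples are dominating
inputs of computed rungs, cf. `rungAt_mono_left`). -/
def fccLadderC18 : List (ℝ × ℝ × ℝ × ℝ) :=
  [(0.1960, 0.5641, 0.3126, 0.5902), (0.2448, 0.4208, 0.3242, 0.4173), (0.2607, 0.3884, 0.2971, 0.3432),
   (0.2442, 0.3409, 0.2619, 0.2939), (0.2044, 0.2789, 0.2142, 0.2411), (0.1454, 0.1966, 0.1516, 0.1725),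
   (0.0844, 0.1129, 0.0877, 0.1026), (0.0476, 0.0635, 0.0490, 0.0578), (0.0354, 0.0477, 0.0362, 0.0430),
   (0.0329, 0.0445, 0.0336, 0.0402)]

/-- Terminal tuple of the `c = 18` fcc ladder (eleven rungs; same fixed point as `fccLadder`). -/
def fccTerminalC18 : ℝ × ℝ × ℝ × ℝ := (0.0325, 0.0439, 0.0332, 0.0398)

/-- The certificate statement of the `c = 18` route. -/
def FccLadderCertC18 : Prop := ChainAt (1 / 100) fccKissingPattern fccEntryC18 fccLadderC18 fccTerminalC18

/-- **M_fcc at the literals from R with `K ≤ 10`, the octahedral-cell cap a-priori, and the `c = 18` certificate chain.** [folklore] -/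
theorem cappedRigidityAt_fcc_of_coarse_ten {K : ℝ} (hK : K ≤ 10) (hR : CoarseCappedRigidityAt K (1 / 100) fccKissingPattern)
    (hQ : CapAprioriAt (54 + 2 * K) K (1 / 100) fccKissingPattern) (hC : FccLadderCertC18) :
    CappedRigidityAt (1 / 100) (1 / 20) fccKissingPattern := by
  have hE : EntryAt (1 / 100) fccEntryC18 fccKissingPattern := by
    intro N y i τ hy hsep hL hCp
    obtain ⟨A, hA⟩ := entryAt_of_coarse_of_capApriori hR hQ N y i τ hy hsep hL hCp
    refine ⟨A, fitAt_mono ?_ ?_ ?_ ?_ hA⟩ <;> simp only [fccEntryC18] <;> nlinarith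
  exact cappedRigidityAt_of_entry_of_chain fccLadderC18 hE hC (by norm_num [fccTerminalC18])


/-! ## The hcp ladder of the same `c = 18` route: `K = 6` ENTERS (`6 → 12.8 → 17.6 → 15.7 → 10.9 → 6.5`, then it is dominated by the fourth
tuple of `hcpLadder` and runs down that chain); `K = 8` and `K = 10` DIVERGE (`8 → 17.1 → 26.6 → 33.9`; `10 → 21.7 → 39.2`; 26 directions). -/

/-- Entry tuple of the `c = 18` route for hcp at `K = 6`. -/
def hcpEntryC18 : ℝ × ℝ × ℝ × ℝ := (0.06, 0.66, 0.12, 0.72)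

/-- The measured hcp ladder of the `c = 18` route (26 directions; successors rounded UP to `1e-4·nn_i`; the fifth tuple is the dominating third
tuple of `hcpLadder`, after which the two chains coincide). -/
def hcpLadderC18 : List (ℝ × ℝ × ℝ × ℝ) :=
  [(0.1278, 0.4415, 0.2056, 0.4770), (0.1764, 0.2808, 0.2277, 0.2908), (0.1570, 0.2161, 0.1703, 0.1998),
   (0.1094, 0.1474, 0.1138, 0.1342), (0.0712, 0.0950, 0.0748, 0.0884), (0.0441, 0.0611, 0.0471, 0.0554),
   (0.0357, 0.0510, 0.0390, 0.0452), (0.0329, 0.0476, 0.0361, 0.0420), (0.0323, 0.0469, 0.0356, 0.0414)]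

/-- The certificate statement of the `c = 18` route for hcp (terminal tuple = `hcpTerminal`). -/
def HcpLadderCertC18 : Prop := ChainAt (1 / 100) hcpKissingPattern hcpEntryC18 hcpLadderC18 hcpTerminal

/-- **M_hcp at the literals from R with `K ≤ 6`, the octahedral-cell cap a-priori, and the `c = 18` certificate chain.** [folklore] -/
theorem cappedRigidityAt_hcp_of_coarse_six {K : ℝ} (hK : K ≤ 6) (hR : CoarseCappedRigidityAt K (1 / 100) hcpKissingPattern)
    (hQ : CapAprioriAt (54 + 2 * K) K (1 / 100) hcpKissingPattern) (hC : HcpLadderCertC18) :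
    CappedRigidityAt (1 / 100) (1 / 20) hcpKissingPattern := by
  have hE : EntryAt (1 / 100) hcpEntryC18 hcpKissingPattern := by
    intro N y i τ hy hsep hL hCp
    obtain ⟨A, hA⟩ := entryAt_of_coarse_of_capApriori hR hQ N y i τ hy hsep hL hCp
    refine ⟨A, fitAt_mono ?_ ?_ ?_ ?_ hA⟩ <;> simp only [hcpEntryC18] <;> nlinarith
  exact cappedRigidityAt_of_entry_of_chain hcpLadderC18 hE hC (by norm_num [hcpTerminal])

/-- **M at the literals `(1/100, 1/20)` with NO bridge hypothesis beyond the hand lane's R at `K ≤ 10` (fcc) / `K ≤ 6` (hcp), the octahedral-cell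
cap a-priori (`Kq = 54 + 2K`, from `OctaCellAt 18`) and the two `c = 18` certificate chains.**  This is the literal-θ reading of the ladder: the
hand constant it asks for is `10 / 6`, not `< 5` (bare `M ⟸ R`, `cappedRigidityAt_of_coarse_of_basin` with a vacuous basin needs `K·θ < η`). [folklore] -/
theorem cappedRigidity_of_coarse_c18 {Kf Kh : ℝ} (hKf : Kf ≤ 10) (hKh : Kh ≤ 6)
    (hRf : CoarseCappedRigidityAt Kf (1 / 100) fccKissingPattern) (hQf : CapAprioriAt (54 + 2 * Kf) Kf (1 / 100) fccKissingPattern)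
    (hRh : CoarseCappedRigidityAt Kh (1 / 100) hcpKissingPattern) (hQh : CapAprioriAt (54 + 2 * Kh) Kh (1 / 100) hcpKissingPattern)
    (hCf : FccLadderCertC18) (hCh : HcpLadderCertC18) : CappedRigidity (1 / 100) (1 / 20) :=
  ⟨cappedRigidityAt_fcc_of_coarse_ten hKf hRf hQf hCf, cappedRigidityAt_hcp_of_coarse_six hKh hRh hQh hCh⟩

end Summit.AtomisticToContinuum.Crystallization.Theorems.FrustratedLawDichotomyTwoShellRigidityLadder

end
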